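import Summits.ResolutionOfSingularities.ResolutionOfSingularities.Theorems.FrobeniusClosingSteerWords21ConstOrderReduction

/-!
# Crux `Steer` (stmt-ResolutionOfSingularities-16345), line `switching-dichotomy` — WORDS 28: §σ2.28 (e) hG4 ↦ hNT4 «NO TANGENTIAL STEP», threaded to `Concl` (the skeleton-local (e0) word `NoTangentialStepPerfect` and its threading) (HOIST of the registered skeleton r52 5a09c4c2f84a0135, l.1493–1674, inside `section HeightSplitTwo` with its `variable {K : Type} [Field K]`)

Holder res-L0-w41-lead-1 g6 on res-L0-w41-plan-1 RULING 47 (E1) / 104b; see `…Words01Core` for the hoist protocol (bodies byte for byte;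
`[cite: …]` / `[folklore]` tags on CLOSED `def … : Prop` words are written «(ref. …)» / «(folklore)» — GATE NOTE of `…Words02Stubs`;
cite keys inside `[cite:]` tags normalised to `references.bib` keys where needed, as in `…Words03Phases`).
Nothing here is a statement of the manuscript [claim: Hironaka2017, status: under-review]. OURS (candidates / vocabulary; AI review is
weaker than expert review).
-/

open Summit.ResolutionOfSingularities.ResolutionOfSingularities.Theses.FrobeniusClosing (IsolatedForcedTermination)
open Literature.AlgebraicGeometry.Resolution (IsAbhyankarPlace FGOver exists_ringKrullDim_eq_and_trdeg_eq
  trdeg_eq_trdeg_of_isFractionRing locAtCentre IsQuadraticTransformAlong SubringDominates IsRsopPart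
  LocalUniformization3 RelLocalUniformization CossartPiltant2019General)
open Summit.ResolutionOfSingularities.ResolutionOfSingularities.Theorems.SteerRankThinness
  (HasProperCoarsening concl_of_hasProperCoarsening rankOne_of_not_hasProperCoarsening)
open Summit.ResolutionOfSingularities.ResolutionOfSingularities.Theorems.PfaffLine

set_option linter.dupNamespace false

namespace Summit.ResolutionOfSingularities.ResolutionOfSingularities.Theorems.SwitchingDichotomy.Words

section SteeredTwo

open IsLocalRing
open Literature.AlgebraicGeometry.Resolution (IsLocalBlowupAlong IsQuadraticTransform IsExcellentRing)

variable {K : Type} [Field K]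


/-! #### §σ2.28 (e) — hG4 ↦ hNT4 «NO TANGENTIAL STEP», threaded to `Concl` (res-L0-w41-strat-2 g2; plan-1 RULINGS 114b/116b/117a/118b; tri-3 g6 R-S
(G2a)/(G2b); tri-2 TRIAGE v15 PART 4 (e) PASS on r37; re-cut AGAINST r38 cc5f2c8f0939be83, spliced before the unique `end HeightSplitTwo`; full rationale in
`L/res-L0-w41-strat-2/STRAT2-MEMO-1.md` §13). THE CUT (tri-3's design W — no `O` in the chain currency; the §σ2.26 reduction and Θ♮'s packaging RE-OPENED
WITH AN OUTPUT): (e0) `NoTangentialStepPerfect` = idea-3's lever VERBATIM (Sketch-g5 cce93cf753969c1a); (e1) `NoTangentialTailHP` + PROVED leaf (reduction with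
output) + `…_two_four_of_pieces`; (Σ) the NAMED `def PointStepsRecurTwoN` (pv-011 e16041012b506916 VERBATIM; = the inline `hrecur` binder of slate9‴/slate10′
up to unfolding) so res-type-028's leaf has a def to target; (e2) `PointTailPersistTwoN` (WORK pv-011: F-B♮ binders + (e1)(p,4) + point steps recur ⇒ the
WEAK persistence clause of (Par-P)); (e3) PROVED glue F-B♮ ⟸ (Σ) ∧ (e2) ∧ (e1)(2,4) through 062's TREE theorem
`OddBranchPersistence.concl_of_coreDatum_of_persistentTail_two`; slate11' (11 binders; hG4 and Θ♮ OFF — slate10' keeps them as the parallel line).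
OURS; candidates, not facts. -/

/-- **(e0) · NoTangentialStepPerfect(c, d)** — res-L0-w41-idea-3 GEN 5's LEVER, VERBATIM (Sketch-g5 cce93cf753969c1a): under G-perf(c, d)'s binders EVERY
step is TRANSVERSAL to the previous exceptional divisor: `(x m) = (x (m+1))` as ideals of `S (m+2)`. Mechanism (Lemma B + (D) p529051; tri-3 S1–S4): a
tangential step makes the restricted radicand on the newest divisor a BINARY even-degree form mod squares ⇒ not isolated when `c ≥ 4`. hNT4 := `∀ e, 2 ≤ e →
NoTangentialStepPerfect 2 4 (2*e)` is WORK (res-D-pv-004 AS stub-10, RULING 116b). OURS. [folklore] -/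
def NoTangentialStepPerfect (p c d : ℕ) : Prop :=
  ∀ (L : Type) [Field L] [CharP L p] (S : ℕ → Subring L) [∀ m, IsLocalRing (S m)]
    (hle : ∀ m, S m ≤ S (m + 1)) (f g : ∀ m, S m) (x : ∀ m, S (m + 1)),
    (∀ m, IsRegularLocalRing (S m)) → (∀ m, IsExcellentRing (S m)) → (∀ m, ringKrullDim (S m) = c) →
    (∀ m, IsQuadraticTransform (S m) (S (m + 1))) →
    (∀ m, Ideal.span ((fun y : S m => (⟨(y : L), hle m y.2⟩ : S (m + 1))) '' (maximalIdeal (S m) : Set (S m)))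
        = Ideal.span {x m}) →
    (∀ m, ((f (m + 1) : S (m + 1)) : L) * ((x m : S (m + 1)) : L) ^ d =
        ((f m : S m) : L) - ((g m : S m) : L) ^ p) →
    (∀ m, ∃ h : S m, f m - h ^ p ∈ maximalIdeal (S m) ^ p) →
    (∀ m (h : S m), f m - h ^ p ∉ maximalIdeal (S m) ^ (d + 1)) →
    (∀ m, HasCleaningDerivations p (S m) (f m) (g m)) →
    (∀ m, PerfectField (IsLocalRing.ResidueField (S m))) →
    (∀ m, HasIsolatedSingularity (RadicandRing (S m) p (f m))) →
    ∀ m, Ideal.span {(⟨((x m : S (m + 1)) : L), hle (m + 1) (x m).2⟩ : S (m + 2))} = Ideal.span {x (m + 1)}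

/-- **(e1) · NoTangentialTailHP(p, c)**: K♭ v2.2-perfect's binders VERBATIM ⇒ «from some stage `m₀` on every step is transversal». ⟸ hNT(c, p·e),
`e ≥ 2`, by `noTangentialTailHP_of_noTangentialStep` (PROVED). OURS. [folklore] -/
def NoTangentialTailHP (p c : ℕ) : Prop :=
  ∀ (L : Type) [Field L] [CharP L p] (S : ℕ → Subring L) [∀ m, IsLocalRing (S m)]
    (hle : ∀ m, S m ≤ S (m + 1)) (f g : ∀ m, S m) (x : ∀ m, S (m + 1)) (e : ℕ → ℕ) (_he : ∀ m, 1 ≤ e m)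
    (_hinf : ∀ m₀, ∃ m, m₀ ≤ m ∧ 2 ≤ e m),
    (∀ m, IsRegularLocalRing (S m)) → (∀ m, IsExcellentRing (S m)) → (∀ m, ringKrullDim (S m) = c) →
    (∀ m, IsQuadraticTransform (S m) (S (m + 1))) →
    (∀ m, Ideal.span ((fun y : S m => (⟨(y : L), hle m y.2⟩ : S (m + 1))) '' (maximalIdeal (S m) : Set (S m)))
        = Ideal.span {x m}) →
    (∀ m, ((f (m + 1) : S (m + 1)) : L) * ((x m : S (m + 1)) : L) ^ (p * e m) =
        ((f m : S m) : L) - ((g m : S m) : L) ^ p) →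
    (∀ m, ∃ h : S m, f m - h ^ p ∈ maximalIdeal (S m) ^ p) →
    (∀ m, HasCleaningDerivations p (S m) (f m) (g m)) →
    (∀ m, PerfectField (IsLocalRing.ResidueField (S m))) →
    (∀ m, HasIsolatedSingularity (RadicandRing (S m) p (f m))) →
    ∃ m₀ : ℕ, ∀ m, m₀ ≤ m →
      Ideal.span {(⟨((x m : S (m + 1)) : L), hle (m + 1) (x m).2⟩ : S (m + 2))} = Ideal.span {x (m + 1)}

/-- **(e1) LEAF — the §σ2.26 v2 reduction RE-OPENED WITH AN OUTPUT** (PROVED; same proof as `noEternalStrippedRadicandChainHP_of_constOrder`: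
the exponent is antitone, constant `= e∞ ≥ 2` from `m₀` on, the tail `n ↦ S (m₀ + n)` with the SAME `f, g, x` is a G-perf(c, p·e∞) chain, and hNT's
conclusion on it is the output; the re-indexing is `Nat.add` defeq). OURS. [folklore] -/
theorem noTangentialTailHP_of_noTangentialStep {p c : ℕ} (hp : p.Prime) (hc : 2 < c)
    (hB2 : DerivationStepTransfer p c) (hCE : CleaningExact p c)
    (hNT : ∀ e : ℕ, 2 ≤ e → NoTangentialStepPerfect p c (p * e)) :
    NoTangentialTailHP p c := by
  intro L _ _ S _ hle f g x e he hinf hreg hexc hdim hqt hspan hlaw hmult hH hperf hiso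
  have hp2 : 2 ≤ p := hp.two_le
  -- (C) at every stage: the full strip is exact
  have hC : ∀ m, f m - g m ^ p ∈ maximalIdeal (S m) ^ (p * e m) ∧
      ∀ h : S m, f m - h ^ p ∉ maximalIdeal (S m) ^ (p * e m + 1) := fun m =>
    hCE hc L (S m) (S (m + 1)) (hle m) (f m) (g m) (f (m + 1)) (x m) (e m) hp (he m) (hreg m) (hreg (m + 1))
      (hexc m) (hexc (m + 1)) (hdim m) (hdim (m + 1)) (hqt m) (hspan m) (hlaw m) (hmult (m + 1)) (hiso (m + 1))
  have hDsub : ∀ m (D : Derivation ℤ (S m) (S m)), D (f m - g m ^ p) = D (f m) := fun m D => by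
    rw [map_sub, derivation_subring_apply_pow_eq_zero p (S m) D (g m), sub_zero]
  have h1le : ∀ m, 1 ≤ p * e m := fun m => le_trans (by omega) (Nat.mul_le_mul hp2 (he m))
  -- (B2): the exponent never increases
  have hstep : ∀ m, e (m + 1) ≤ e m := by
    intro m
    obtain ⟨hmem, hopt⟩ := hC m
    obtain ⟨D, hD⟩ := hH m (p * e m) hopt hmem
    have hDf : D (f m) ∈ maximalIdeal (S m) ^ (p * e m - 1) := by
      rw [← hDsub m D]
      refine derivation_apply_mem_pow_of_mem_pow_succ D _ (p * e m - 1) ?_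
      rw [Nat.sub_add_cancel (h1le m)]
      exact hmem
    have hν : ∃ ν : ℕ, D (f m) ∈ maximalIdeal (S m) ^ ν ∧ D (f m) ∉ maximalIdeal (S m) ^ (ν + 1) ∧
        (p * e m = ν + 1 ∨ (p * e m = ν ∧ ∀ y ∈ maximalIdeal (S m), D y ∈ maximalIdeal (S m))) := by
      rcases hD with hD | ⟨hlog, hD⟩
      · refine ⟨p * e m - 1, hDf, ?_, Or.inl (Nat.sub_add_cancel (h1le m)).symm⟩
        rw [Nat.sub_add_cancel (h1le m)]
        exact hD
      · by_cases hmid : D (f m) ∈ maximalIdeal (S m) ^ (p * e m)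
        · exact ⟨p * e m, hmid, hD, Or.inr ⟨rfl, hlog⟩⟩
        · refine ⟨p * e m - 1, hDf, ?_, Or.inl (Nat.sub_add_cancel (h1le m)).symm⟩
          rw [Nat.sub_add_cancel (h1le m)]
          exact hmid
    obtain ⟨ν, hν1, hν2, hν3⟩ := hν
    have hνle : ν ≤ p * e m := by
      rcases hν3 with h | ⟨h, _⟩ <;> omega
    obtain ⟨D₁, hD₁⟩ := hB2 L (S m) (S (m + 1)) (hle m) (f m) (g m) (f (m + 1)) (x m) (e m) hp (he m) (hreg m)
      (hreg (m + 1)) (hdim m) (hdim (m + 1)) (hqt m) (hspan m) (hlaw m) ν ⟨D, hν1, hν2, hν3⟩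
    obtain ⟨hmem1, -⟩ := hC (m + 1)
    have hD₁f : D₁ (f (m + 1)) ∈ maximalIdeal (S (m + 1)) ^ (p * e (m + 1) - 1) := by
      rw [← hDsub (m + 1) D₁]
      refine derivation_apply_mem_pow_of_mem_pow_succ D₁ _ (p * e (m + 1) - 1) ?_
      rw [Nat.sub_add_cancel (h1le (m + 1))]
      exact hmem1
    refine not_lt.mp fun hlt => hD₁ (Ideal.pow_le_pow_right ?_ hD₁f)
    have hmul : p * (e m + 1) ≤ p * e (m + 1) := Nat.mul_le_mul_left p (Nat.succ_le_of_lt hlt)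
    rw [mul_add_one] at hmul
    have h1 := h1le (m + 1)
    generalize p * e m = a at hνle hmul
    generalize p * e (m + 1) = b at hmul h1
    omega
  have hanti : ∀ m n : ℕ, e (m + n) ≤ e m := by
    intro m n
    induction n with
    | zero => exact le_rfl
    | succ n ih => exact (hstep (m + n)).trans ih
  classical
  have hP : ∃ v : ℕ, ∃ m, e m = v := ⟨e 0, 0, rfl⟩
  obtain ⟨m₀, hm₀⟩ := Nat.find_spec hP
  have hmin : ∀ m, Nat.find hP ≤ e m := fun m => Nat.find_min' hP ⟨m, rfl⟩
  have hconst : ∀ n, e (m₀ + n) = Nat.find hP := fun n => le_antisymm ((hanti m₀ n).trans hm₀.le) (hmin _)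
  obtain ⟨m, hm, h2⟩ := hinf m₀
  have hv2 : 2 ≤ Nat.find hP := by
    obtain ⟨n, rfl⟩ := Nat.exists_eq_add_of_le hm
    exact h2.trans (hconst n).le
  haveI : ∀ n, IsLocalRing ((fun n => S (m₀ + n)) n) := fun n => inferInstance
  have hlaw' : ∀ n, ((f (m₀ + n + 1) : S (m₀ + n + 1)) : L) * ((x (m₀ + n) : S (m₀ + n + 1)) : L) ^ (p * Nat.find hP) =
      ((f (m₀ + n) : S (m₀ + n)) : L) - ((g (m₀ + n) : S (m₀ + n)) : L) ^ p := fun n => by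
    have hl := hlaw (m₀ + n)
    rw [hconst n] at hl
    exact hl
  have hopt' : ∀ n (h : S (m₀ + n)), f (m₀ + n) - h ^ p ∉ maximalIdeal (S (m₀ + n)) ^ (p * Nat.find hP + 1) := fun n h => by
    have ho := (hC (m₀ + n)).2 h
    rw [hconst n] at ho
    exact ho
  have hout := hNT (Nat.find hP) hv2 L (fun n => S (m₀ + n)) (fun n => hle (m₀ + n)) (fun n => f (m₀ + n)) (fun n => g (m₀ + n))
    (fun n => x (m₀ + n)) (fun n => hreg (m₀ + n)) (fun n => hexc (m₀ + n)) (fun n => hdim (m₀ + n))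
    (fun n => hqt (m₀ + n)) (fun n => hspan (m₀ + n)) hlaw' (fun n => hmult (m₀ + n)) hopt' (fun n => hH (m₀ + n))
    (fun n => hperf (m₀ + n)) (fun n => hiso (m₀ + n))
  refine ⟨m₀, fun m hm => ?_⟩
  obtain ⟨n, rfl⟩ := Nat.exists_eq_add_of_le hm
  exact hout n

/-- **(e1) at (2, 4)** ⟸ hNT4 ((B2)/(C) by `derivationStepTransfer_holds` / `cleaningExact_holds`). Pure logic. OURS. [folklore] -/
theorem noTangentialTailHP_two_four_of_pieces
    (hNT4 : ∀ e : ℕ, 2 ≤ e → NoTangentialStepPerfect 2 4 (2 * e)) : NoTangentialTailHP 2 4 :=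
  noTangentialTailHP_of_noTangentialStep Nat.prime_two (by norm_num) (derivationStepTransfer_holds 2 4) (cleaningExact_holds 2 4) hNT4

/-- **(Σ) · PointStepsRecurTwoN** (SUPPORT, provable — plan-1 RULING 110b; prover res-type-028): along an eternal σ_top-steered run of a
`CoreDatum 2 4` datum from a normalised start, with no dominant tail, eventually HIGH, only finitely many positive steps of height `≥ 2` and
infinitely many positive steps, POINT STEPS RECUR: there is a point step beyond every stage. (Mechanism: otherwise from some stage on every
step strips a height-one prime of a FIXED regular member `R`; the cleaned order `ν*(f) = sup_g ord_𝔪 (f − g²)` drops by `≥ 2` at each strip,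
so it is `∞` at the first such stage, `f` is an `𝔪`-adic limit of squares, hence a square in `R` by Frobenius-closedness of the excellent
normal local domain `R` (`exists_pow_eq_of_adicCauchy_of_isExcellentRing`), contradicting the non-triviality of the torsor.) OURS. (folklore) -/
def PointStepsRecurTwoN : Prop :=
  ∀ p : ℕ, p = 2 →
    ∀ (k K : Type) [Field k] [CharP k p] [PerfectField k] [Field K] [Algebra k K]
    (O : ValuationSubring K) (A₀ : Subalgebra k K) (h₀ : A₀.toSubring ≤ O.toSubring) (t : K),
    CoreDatum p 4 k K O A₀ h₀ t → ¬ HasProperCoarsening O →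
    ∀ (R : ℕ → Subring K) (P : (i : ℕ) → Ideal (R i)) (s : ℕ → K),
      R 0 = locAtCentre A₀.toSubring O → NormalAt O (R 0) p t → IsSteeredRun O R P t p s →
      (¬ ∃ i₀ c : ℕ, 1 ≤ c ∧ IsDominantTail R P i₀ c) →
      (∃ i₀ : ℕ, ∀ i, i₀ ≤ i → IsHighOrderAt R s p i) →
      ¬ HeightTwoStepsInfinite R P → {j | IsPosStep R P j}.Infinite →
      ∀ i₀ : ℕ, ∃ i, i₀ ≤ i ∧ IsPointStep R P i

/-- **(e2) · PointTailPersistTwoN** (WORK, owner res-D-pv-011; RULING 117c): F-B♮'s binders VERBATIM + `NoTangentialTailHP p 4` + «point steps recur» ⇒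
the WEAK persistence clause of (Par-P) VERBATIM (one FIXED `x ∈ 𝔪_O ∖ 0` divides every later `y ∈ 𝔪_O ∩ R i` in a later member; the «∃ j > i» form
tolerates strip stages). Recipe: `PointTail.exists_chainHP_of_pointTail` (O1 members at visits, O2 visits cofinal, O3 `x m` = the run's exceptional
parameter) + (e1) on that chain ⇒ eventual span equality ⇒ member units have `O`-value 1 ⇒ `v (x m)` constant ⇒ `IsExcParamAlong` of `x m₀` at every
later visit ⇒ res-type-062's `OddBranchPersistence.weakPersistence_of_pointSteps`. OURS. (folklore) -/
def PointTailPersistTwoN : Prop :=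
  ∀ p : ℕ, p = 2 →
    ∀ (k K : Type) [Field k] [CharP k p] [PerfectField k] [Field K] [Algebra k K]
    (O : ValuationSubring K) (A₀ : Subalgebra k K) (h₀ : A₀.toSubring ≤ O.toSubring) (t : K),
    CoreDatum p 4 k K O A₀ h₀ t → ¬ HasProperCoarsening O →
    ∀ (R : ℕ → Subring K) (P : (i : ℕ) → Ideal (R i)) (s : ℕ → K),
      R 0 = locAtCentre A₀.toSubring O → NormalAt O (R 0) p t → IsSteeredRun O R P t p s →
      (¬ ∃ i₀ c : ℕ, 1 ≤ c ∧ IsDominantTail R P i₀ c) →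
      (∃ i₀ : ℕ, ∀ i, i₀ ≤ i → IsHighOrderAt R s p i) →
      ¬ HeightTwoStepsInfinite R P → {j | IsPosStep R P j}.Infinite →
      (∃ i₀ : ℕ, ∀ i, i₀ ≤ i → IsPointStep R P i →
        ∃ hs : s i ^ p ∈ R i, HasIsolatedSingularity (RadicandRing (R i) p ⟨s i ^ p, hs⟩)) →
      NoTangentialTailHP p 4 →
      (∀ i₀ : ℕ, ∃ i, i₀ ≤ i ∧ IsPointStep R P i) →
      ∃ i₀ : ℕ, ∃ x : K, x ≠ 0 ∧ x ∈ O ∧ O.valuation x < 1 ∧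
        ∀ i, i₀ ≤ i → ∀ y ∈ R i, O.valuation y < 1 → ∃ j, i < j ∧ y / x ∈ R j


end SteeredTwo

end Summit.ResolutionOfSingularities.ResolutionOfSingularities.Theorems.SwitchingDichotomy.Words
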